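import Summits.Ventures.HSemireg.Pad4TowerTorusBlind
import Summits.Ventures.HSemireg.Pad4TowerB1OddBoostBlind

/-!
# Pad4Tower ∕ ChiralityBlind (part 1 of 2) — CHIRALITY BLINDNESS of the typed static game under the reflection `β ↦ β̄`: the reflection, cells, configurations, RULE D

HONEST FRAMING. A folder note of the №3 bc5-witness planner `hodge-bloch-bc5-plan` g10 (evidence-only lineage on stmt-HodgeConjecture-18881
`EightfoldBlochSeeds.BlochSeedDiscOne`; skeleton `Cruxes/BlochSeedDiscOne/Lines/birth.lean` 814a6a70c14e831a). Theorems ABOUT THE TYPED STATIC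
PREDICATES OF RECORD only (`RuleDMu4Closed`, `XMinusClosed`, `XPlusClosed`, `A2IMinusClosed`, `A2IPlusClosed`, `InDiamond`, `InCone`, `G1Closed`,
`HasOddFC`, `StaticH1`); nothing here is an object, a σ, a seed or a census row; NOTHING HERE SAYS THAT HC ∕ HC_CM ∕ HC_AV ∕ H2 ∕ 18881 ∕ (T_h)
HOLDS OR FAILS; width toward H2 = 0. No `sorry`, no `axiom`, no `instance`, no notation, no Literature fact.

WHAT. Director-hodge R19.18 (2)–(3) (hsemireg bus l.34937, 2026-08-29): the two letter dictionaries in use on the machine side (`PH` in s4-search-1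
g28's coordinate expander, `DIR` in the anomaly loader's `parse_letter` ∕ negation's `gen_cert.py`) differ by COMPLEX CONJUGATION `Im β ↦ −Im β`
(`ℓ_u ↦ ℓ_ū`), which is NOT an element of `G₁ = ⟨Δ⟩ × S₄`; «nobody has proved the static families reflection-invariant … if it is a fact it is
worth one kernel lemma later (it would make chirality moot)». THIS FILE PROVES IT, h-uniformly and census-free, in the layout of gs-eng-2 g53's
LEMMA T (`Pad4TowerTorusBlindBase` ∕ `Pad4TowerTorusBlind`, torus blindness): the reflection `conjPt (α, Re β, Im β) = (α, Re β, −Im β)` acts on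
cells factorwise (`MCell.conj`) and on two-level configurations (`MConfig.conjImage`); it carries the null direction `k` to `crf k = −k = 3k`
(`conjPt_ray`), fixes `α`, `cabs`, `isApex`, the causal type of same-factor differences, RULE D's coordinate VALUES (`coord_conjPt`:
`coord (conjPt x) (crf k) = coord x k`) and adaptedness, commutes with the dual of `Pad4TowerRuleDMu4Dual` (`dual_conjImage`) and with
`S₄`, and conjugates `Δ` to `Δ⁻¹ = Δ³` (`conj_delta : Z.conj.delta = Z.delta.delta.delta.conj`) — so `Δ`-closure is kept although the
reflection does not commute with `Δ`. THEOREMS: `ruleDMu4Closed_conjImage`, `xMinusClosed_conjImage`, `xPlusClosed_conjImage`,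
`a2iMinusClosed_conjImage`, `a2iPlusClosed_conjImage`, the `ι_h`-dual readings for every `h` (`a2iMinusClosed_dual_conjImage` = the anomaly
lens's `AFlatStatic h`, `xMinusClosed_dual_conjImage`, `ruleDMu4Closed_dual_conjImage`), `inDiamond_conjImage`, `inCone_conjImage`, inside a
diamond `lineSupport_conjImage` (the negation lens's `LineSupport h`, definiens verbatim) ∕ `ceilingAnchored_conjImage` ∕ `floorAnchored_conjImage`,
`g1Closed_conjImage`, `hasOddFC_conjImage` (the phase-bit pattern is conjugation-invariant: `conj_pat`), `staticH1_conjImage`, bundled as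
**`staticGame_chiralityBlind`**; consequences for the seeds of record: a configuration refutes `(T_h) = SeedB1OddDiamondG1H1 h`, `(T_∞)`,
`(TL_h) = SeedB1OddLine h`, `(SP_h)` or `SeedB1OddAFlat h` iff its mirror image does (`seedB1OddCounterexample_conj_iff`,
`seedB1OddConeCounterexample_conj_iff`, `seedB1OddLineCounterexample_conj_iff`, `seedB1OddSpanningCounterexample_conj_iff`,
`seedB1OddAFlatCounterexample_conj_iff`), so machine searches, replays and kernel transcriptions may be run in either chirality convention
(one sign convention suffices for replay (b) of R19.21 (1)), and a replay mismatch that disappears under conjugation cannot come from the typed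
predicates (R19.18 (2)'s «DICTIONARY event» has no typed content).

FILE LAYOUT (tree re-cut of the folder note `pub-hsemireg/hodge-bloch-bc5-plan/work/g10/lean/ChiralityBlind.lean` sha16 dfecbae03a48c221 — farm
`lean check` rc 0, std axioms; director-hodge R19.26 (hsemireg bus l.34995) «kernel-citable on landing»; LADDER DESK: tree name
`Pad4TowerChiralityBlind`): THIS FILE = §1 the reflection on factor points, §2 cells, §3 configurations (incl. `dual_conjImage`, `conj_delta`), §4 RULE D;
the sequel `Pad4TowerChiralityBlindStatic` = §5 X family, §6 A2I family, §7 diamond ∕ cone ∕ line ∕ anchoring, §8 `G₁` and odd FC, §9 the assembled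
theorem `staticGame_chiralityBlind` + the seed corollaries, §10 `decide` probes. Every name, statement and proof is the folder note’s, unchanged
(one docstring added); the two files concatenated elaborate as the note does.

SOURCES: `Pad4TowerTorusBlindBase.lean` ∕ `Pad4TowerTorusBlind.lean` (gs-eng-2 g53; the layout and every transport step are theirs, with
`phasePt (η f)` ↦ `conjPt` and `dsh (η f)` ↦ `crf`), `Pad4TowerB1OddSpanControl.lean` (`closed_image_iff`, `InCone`, `FloorAnchored`,
`SeedB1OddDiamondG1H1`, `SeedB1OddConeG1H1`), `Pad4TowerB1OddBoostBlind.lean` (`CeilingAnchored`), `Pad4TowerSeedB1Odd.lean` (`HasOddFC`,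
`OddPat`), `Pad4TowerFCCoreSeam.lean` (`kbit`, `MCell.pat`), `Pad4TowerDiamondMu4.lean` (`InDiamond`, `OnCeiling`, `OnFloor`); director-hodge
R19.18 l.34937, R19.21 l.34973. Typed ≠ proved for every (T_h). -/

namespace Summit.Ventures.HSemireg.Pad4Tower

open Finset

namespace Chirality

/-! ## §1 The reflection on factor points: direction map `crf`, covariance of the primitives -/

/-- complex conjugation of the phase coordinate: `(α, Re β, Im β) ↦ (α, Re β, −Im β)` (`ℓ_u ↦ ℓ_ū`). -/
def conjPt (x : BPoint) : BPoint := (x.1, x.2.1, -x.2.2)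

/-- the direction map of the reflection: `k ↦ −k = 3k` (fixes the real directions `0, 2`, swaps the imaginary ones `1, 3`). -/
abbrev crf (k : Fin 4) : Fin 4 := 3 * k

/-- the reflection is an involution on points. -/
theorem conjPt_conjPt (x : BPoint) : conjPt (conjPt x) = x := by
  obtain ⟨a, b, c⟩ := x; simp [conjPt]

/-- the reflection is injective on points. -/
theorem conjPt_injective : Function.Injective conjPt := fun x y h => by
  rw [← conjPt_conjPt x, ← conjPt_conjPt y, h]

/-- the reflection fixes `α`. -/
theorem conjPt_fst (x : BPoint) : (conjPt x).1 = x.1 := rfl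

/-- the reflection carries the null ray of direction `k` to the one of direction `crf k`. -/
theorem conjPt_ray (x : BPoint) (k : Fin 4) (e : ℤ) : conjPt (ray x k e) = ray (conjPt x) (crf k) e := by
  obtain ⟨a, b, c⟩ := x
  fin_cases k <;> simp [conjPt, ray, crf] <;> ring

/-- same-factor differences reflect with the points. -/
theorem bsub_conjPt (x y : BPoint) : bsub (conjPt x) (conjPt y) = conjPt (bsub x y) := by
  obtain ⟨a, b, c⟩ := x; obtain ⟨a', b', c'⟩ := y
  simp only [bsub, conjPt, Prod.mk.injEq]
  exact ⟨trivial, trivial, by ring⟩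

/-- «effective» (future-causal) is reflection-invariant. -/
theorem effective_conjPt (d : BPoint) : Effective (conjPt d) ↔ Effective d := by
  obtain ⟨a, b, c⟩ := d; simp only [Effective, conjPt, neg_sq]

/-- «timelike» is reflection-invariant. -/
theorem timelike_conjPt (d : BPoint) : Timelike (conjPt d) ↔ Timelike d := by
  obtain ⟨a, b, c⟩ := d; simp only [Timelike, conjPt, neg_sq]

/-- «spacelike» is reflection-invariant. -/
theorem spacelike_conjPt (d : BPoint) : Spacelike (conjPt d) ↔ Spacelike d := by
  obtain ⟨a, b, c⟩ := d; simp only [Spacelike, conjPt, neg_sq]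

/-- «strictly null-below» is reflection-invariant. -/
theorem nullBelow_conjPt (y x : BPoint) : NullBelow (conjPt y) (conjPt x) ↔ NullBelow y x := by
  obtain ⟨a, b, c⟩ := x; obtain ⟨a', b', c'⟩ := y
  have e : (-c - -c') ^ 2 = (c - c') ^ 2 := by ring
  simp only [NullBelow, conjPt, e]

/-- apex points stay apex points. -/
theorem isApex_conjPt (x : BPoint) : isApex (conjPt x) ↔ isApex x := by
  obtain ⟨a, b, c⟩ := x; simp [isApex, conjPt]

/-- the encoder's charge `cabs` is reflection-invariant. -/
theorem cabs_conjPt (x : BPoint) : cabs (conjPt x) = cabs x := by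
  obtain ⟨a, b, c⟩ := x; simp [cabs, conjPt, abs_neg]

/-- RULE D's frame coordinate `k` becomes the coordinate `crf k` of the reflected point (same VALUE). -/
theorem coord_conjPt (x : BPoint) (k : Fin 4) : coord (conjPt x) (crf k) = coord x k := by
  obtain ⟨a, b, c⟩ := x; fin_cases k <;> simp [coord, conjPt, crf]

/-- adaptedness to a frame follows the direction map. -/
theorem adapted_conjPt (x : BPoint) (k : Fin 4) : Adapted (conjPt x) (crf k) ↔ Adapted x k := by
  obtain ⟨a, b, c⟩ := x; fin_cases k <;> simp [Adapted, conjPt, crf]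

/-- the direction map is injective. -/
theorem crf_injective : Function.Injective crf := by decide

/-- the direction map commutes with passing to the antipode. -/
theorem crf_add_two (k : Fin 4) : crf (k + 2) = crf k + 2 := by fin_cases k <;> decide

/-- RULE D's admissible cover directions follow the map. -/
theorem dirOK_conjPt (x : BPoint) (k a : Fin 4) : DirOK (conjPt x) (crf k) (crf a) ↔ DirOK x k a := by
  simp only [DirOK, isApex_conjPt, ← crf_add_two, crf_injective.eq_iff, crf_injective.ne_iff]

/-- the direction map is an involution … -/
theorem crf_crf (k : Fin 4) : crf (crf k) = k := by fin_cases k <;> decide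

/-- … hence re-indexing a universal over the four directions along it is harmless … -/
theorem forall_crf {p : Fin 4 → Prop} : (∀ k, p (crf k)) ↔ ∀ k, p k :=
  ⟨fun h k => by simpa [crf_crf] using h (crf k), fun h k => h _⟩

/-- … and so is re-indexing an existential. -/
theorem exists_crf {p : Fin 4 → Prop} : (∃ k, p (crf k)) ↔ ∃ k, p k :=
  ⟨fun ⟨k, hk⟩ => ⟨_, hk⟩, fun ⟨k, hk⟩ => ⟨crf k, by simpa [crf_crf] using hk⟩⟩

/-- the ray relation on one factor, reflected: `y` is `e` steps of direction `k` above `x`. -/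
theorem conjPt_eq_ray_iff (x y : BPoint) (k : Fin 4) (e : ℤ) : conjPt y = ray (conjPt x) (crf k) e ↔ y = ray x k e := by
  rw [← conjPt_ray]; exact conjPt_injective.eq_iff

/-! ## §2 Cells: `MCell.conj` and the leg ∕ cover relations -/

/-- the reflected cell, factorwise. -/
def _root_.Summit.Ventures.HSemireg.Pad4Tower.MCell.conj (Z : MCell) : MCell := fun f => conjPt (Z f)

/-- the reflected cell, factorwise. -/
theorem conj_apply (Z : MCell) (f : Fin 4) : Z.conj f = conjPt (Z f) := rfl

/-- the reflection is an involution on cells … -/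
theorem conj_conj (Z : MCell) : Z.conj.conj = Z := by
  funext f; simp only [conj_apply, conjPt_conjPt]

/-- … hence injective. -/
theorem conj_injective : Function.Injective MCell.conj := fun Z Z' h => by rw [← conj_conj Z, ← conj_conj Z', h]

/-- agreement off one factor is reflection-invariant. -/
theorem magree_conj (P Z : MCell) (σ : Fin 4) : MAgree P.conj Z.conj σ ↔ MAgree P Z σ :=
  ⟨fun h g hg => conjPt_injective (h g hg), fun h g hg => by simp only [conj_apply, h g hg]⟩

/-- agreement off two factors is reflection-invariant. -/
theorem magree2_conj (P Z : MCell) (g j : Fin 4) : MAgree2 P.conj Z.conj g j ↔ MAgree2 P Z g j :=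
  ⟨fun h f h1 h2 => conjPt_injective (h f h1 h2), fun h f h1 h2 => by simp only [conj_apply, h f h1 h2]⟩

/-- a leg in direction `k` becomes a leg in direction `crf k`. -/
theorem uPartner_conj (Z q : MCell) (σ k : Fin 4) : UPartner Z.conj q.conj σ (crf k) ↔ UPartner Z q σ k := by
  simp only [UPartner, magree_conj, conj_apply, conjPt_fst]
  constructor
  · rintro ⟨h1, h2, h3⟩
    refine ⟨h1, h2, conjPt_injective ?_⟩
    rw [h3, conjPt_ray]
  · rintro ⟨h1, h2, h3⟩
    refine ⟨h1, h2, ?_⟩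
    rw [h3, conjPt_ray, ← h3]

/-- the leg relation between two cells on one factor, reflected. -/
theorem leg_conj (X Y : MCell) (g a : Fin 4) :
    ((Y.conj g).1 < (X.conj g).1 ∧ X.conj g = ray (Y.conj g) (crf a) ((X.conj g).1 - (Y.conj g).1)) ↔
      ((Y g).1 < (X g).1 ∧ X g = ray (Y g) a ((X g).1 - (Y g).1)) := by
  simp only [conj_apply, conjPt_fst]
  constructor
  · rintro ⟨h1, h2⟩; exact ⟨h1, conjPt_injective (by rw [h2, conjPt_ray])⟩
  · rintro ⟨h1, h2⟩; refine ⟨h1, ?_⟩; rw [h2, conjPt_ray, ← h2]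

/-! ## §3 Configurations: the mirror image -/

/-- **the MIRROR IMAGE of a two-level configuration**: every cell of both levels reflected. -/
def _root_.Summit.Ventures.HSemireg.Pad4Tower.MConfig.conjImage (C : MConfig) : MConfig :=
  ⟨C.lower.image MCell.conj, C.upper.image MCell.conj⟩

/-- membership in the lower level of the mirror image. -/
theorem mem_conjImage_lower {C : MConfig} {X : MCell} : X ∈ C.conjImage.lower ↔ ∃ Z ∈ C.lower, Z.conj = X := by
  simp [MConfig.conjImage, Finset.mem_image]

/-- membership in the upper level of the mirror image. -/
theorem mem_conjImage_upper {C : MConfig} {X : MCell} : X ∈ C.conjImage.upper ↔ ∃ P ∈ C.upper, P.conj = X := by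
  simp [MConfig.conjImage, Finset.mem_image]

/-- a reflected cell lies in the reflected lower level iff the cell lies in the lower level. -/
theorem conj_mem_conjImage_lower {C : MConfig} {Z : MCell} : Z.conj ∈ C.conjImage.lower ↔ Z ∈ C.lower := by
  rw [mem_conjImage_lower]
  exact ⟨fun ⟨Z', hZ', e⟩ => conj_injective e ▸ hZ', fun h => ⟨Z, h, rfl⟩⟩

/-- a reflected cell lies in the reflected upper level iff the cell lies in the upper level. -/
theorem conj_mem_conjImage_upper {C : MConfig} {P : MCell} : P.conj ∈ C.conjImage.upper ↔ P ∈ C.upper := by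
  rw [mem_conjImage_upper]
  exact ⟨fun ⟨P', hP', e⟩ => conj_injective e ▸ hP', fun h => ⟨P, h, rfl⟩⟩

/-- a universal statement over the upper cells of the image is one over the upper cells of `C`. -/
theorem forall_conjImage_upper {C : MConfig} {p : MCell → Prop} : (∀ P ∈ C.conjImage.upper, p P) ↔ ∀ P ∈ C.upper, p P.conj := by
  constructor
  · intro h P hP; exact h _ (conj_mem_conjImage_upper.mpr hP)
  · intro h X hX; obtain ⟨P, hP, rfl⟩ := mem_conjImage_upper.mp hX; exact h P hP

/-- a universal statement over the lower cells of the image is one over the lower cells of `C`. -/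
theorem forall_conjImage_lower {C : MConfig} {p : MCell → Prop} : (∀ Z ∈ C.conjImage.lower, p Z) ↔ ∀ Z ∈ C.lower, p Z.conj := by
  constructor
  · intro h Z hZ; exact h _ (conj_mem_conjImage_lower.mpr hZ)
  · intro h X hX; obtain ⟨Z, hZ, rfl⟩ := mem_conjImage_lower.mp hX; exact h Z hZ

/-- an existential statement over the upper cells of the image is one over the upper cells of `C`. -/
theorem exists_conjImage_upper {C : MConfig} {p : MCell → Prop} : (∃ P ∈ C.conjImage.upper, p P) ↔ ∃ P ∈ C.upper, p P.conj := by
  constructor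
  · rintro ⟨X, hX, hp⟩; obtain ⟨P, hP, rfl⟩ := mem_conjImage_upper.mp hX; exact ⟨P, hP, hp⟩
  · rintro ⟨P, hP, hp⟩; exact ⟨_, conj_mem_conjImage_upper.mpr hP, hp⟩

/-- an existential statement over the lower cells of the image is one over the lower cells of `C`. -/
theorem exists_conjImage_lower {C : MConfig} {p : MCell → Prop} : (∃ Z ∈ C.conjImage.lower, p Z) ↔ ∃ Z ∈ C.lower, p Z.conj := by
  constructor
  · rintro ⟨X, hX, hp⟩; obtain ⟨Z, hZ, rfl⟩ := mem_conjImage_lower.mp hX; exact ⟨Z, hZ, hp⟩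
  · rintro ⟨Z, hZ, hp⟩; exact ⟨_, conj_mem_conjImage_lower.mpr hZ, hp⟩

/-- the mirror image is an involution on configurations. -/
theorem conjImage_conjImage (C : MConfig) : C.conjImage.conjImage = C := by
  obtain ⟨L, U⟩ := C
  simp only [MConfig.conjImage, Finset.image_image, MConfig.mk.injEq]
  have e : MCell.conj ∘ MCell.conj = id := funext conj_conj
  simp [e]

/-! ## §4 RULE D is chirality-blind -/

section RuleD

variable (C : MConfig)

/-- service below is reflection-covariant. -/
theorem mServedBelow_conj (Z : MCell) (f k : Fin 4) : MServedBelow C.conjImage Z.conj f (crf k) ↔ MServedBelow C Z f k := by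
  simp only [MServedBelow, exists_conjImage_upper, uPartner_conj]

/-- service above is reflection-covariant. -/
theorem mServedAbove_conj (P : MCell) (f k : Fin 4) : MServedAbove C.conjImage P.conj f (crf k) ↔ MServedAbove C P f k := by
  simp only [MServedAbove, exists_conjImage_lower, uPartner_conj]

/-- settled coordinates below are reflection-covariant. -/
theorem settledBelow_conj (Z : MCell) (f k : Fin 4) : SettledBelow C.conjImage Z.conj f (crf k) ↔ SettledBelow C Z f k := by
  simp only [SettledBelow]
  rw [← exists_crf]
  simp only [mServedBelow_conj, ← crf_add_two, crf_injective.ne_iff]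

/-- settled coordinates above are reflection-covariant. -/
theorem settledAbove_conj (P : MCell) (f k : Fin 4) : SettledAbove C.conjImage P.conj f (crf k) ↔ SettledAbove C P f k := by
  simp only [SettledAbove]
  rw [← exists_crf]
  simp only [mServedAbove_conj, ← crf_add_two, crf_injective.ne_iff]

/-- (r2a) covers below are reflection-covariant. -/
theorem mCoverBelow_conj (Z : MCell) (g a j b : Fin 4) :
    MCoverBelow C.conjImage Z.conj g (crf a) j (crf b) ↔ MCoverBelow C Z g a j b := by
  simp only [MCoverBelow, exists_conjImage_upper, magree2_conj]
  refine exists_congr fun P => and_congr_right fun _ => and_congr_right fun _ => ?_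
  have h1 := leg_conj Z P g a
  have h2 := leg_conj Z P j b
  constructor
  · rintro ⟨a1, a2, a3, a4⟩; exact ⟨(h1.mp ⟨a1, a2⟩).1, (h1.mp ⟨a1, a2⟩).2, (h2.mp ⟨a3, a4⟩).1, (h2.mp ⟨a3, a4⟩).2⟩
  · rintro ⟨a1, a2, a3, a4⟩; exact ⟨(h1.mpr ⟨a1, a2⟩).1, (h1.mpr ⟨a1, a2⟩).2, (h2.mpr ⟨a3, a4⟩).1, (h2.mpr ⟨a3, a4⟩).2⟩

/-- (r2a) covers above are reflection-covariant. -/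
theorem mCoverAbove_conj (P : MCell) (g a j b : Fin 4) :
    MCoverAbove C.conjImage P.conj g (crf a) j (crf b) ↔ MCoverAbove C P g a j b := by
  simp only [MCoverAbove, exists_conjImage_lower, magree2_conj]
  refine exists_congr fun N => and_congr_right fun _ => and_congr_right fun _ => ?_
  have h1 := leg_conj N P g a
  have h2 := leg_conj N P j b
  constructor
  · rintro ⟨a1, a2, a3, a4⟩; exact ⟨(h1.mp ⟨a1, a2⟩).1, (h1.mp ⟨a1, a2⟩).2, (h2.mp ⟨a3, a4⟩).1, (h2.mp ⟨a3, a4⟩).2⟩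
  · rintro ⟨a1, a2, a3, a4⟩; exact ⟨(h1.mpr ⟨a1, a2⟩).1, (h1.mpr ⟨a1, a2⟩).2, (h2.mpr ⟨a3, a4⟩).1, (h2.mpr ⟨a3, a4⟩).2⟩

/-- covered coordinate pairs below are reflection-covariant. -/
theorem coveredBelow_conj (Z : MCell) (g k j k' : Fin 4) :
    CoveredBelow C.conjImage Z.conj g (crf k) j (crf k') ↔ CoveredBelow C Z g k j k' := by
  simp only [CoveredBelow]
  rw [← exists_crf]
  refine exists_congr fun a => ?_
  rw [← exists_crf]
  refine exists_congr fun b => ?_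
  rw [conj_apply, dirOK_conjPt, conj_apply, dirOK_conjPt, mCoverBelow_conj]

/-- covered coordinate pairs above are reflection-covariant. -/
theorem coveredAbove_conj (P : MCell) (g k j k' : Fin 4) :
    CoveredAbove C.conjImage P.conj g (crf k) j (crf k') ↔ CoveredAbove C P g k j k' := by
  simp only [CoveredAbove]
  rw [← exists_crf]
  refine exists_congr fun a => ?_
  rw [← exists_crf]
  refine exists_congr fun b => ?_
  rw [conj_apply, dirOK_conjPt, conj_apply, dirOK_conjPt, mCoverAbove_conj]

/-- **RULE D at an `N`-cell is chirality-blind.** -/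
theorem ruleDMu4N_conj (Z : MCell) : RuleDMu4N C.conjImage Z.conj ↔ RuleDMu4N C Z := by
  simp only [RuleDMu4N]
  refine forall_congr' fun g => forall_congr' fun j => imp_congr_right fun _ => ?_
  rw [← forall_crf]
  refine forall_congr' fun k => ?_
  rw [← forall_crf]
  refine forall_congr' fun k' => ?_
  rw [conj_apply, adapted_conjPt, conj_apply, adapted_conjPt, coord_conjPt, coord_conjPt, settledBelow_conj, settledBelow_conj,
    coveredBelow_conj]

/-- **RULE D at a `P`-cell is chirality-blind.** -/
theorem ruleDMu4P_conj (P : MCell) : RuleDMu4P C.conjImage P.conj ↔ RuleDMu4P C P := by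
  simp only [RuleDMu4P]
  refine forall_congr' fun g => forall_congr' fun j => imp_congr_right fun _ => ?_
  rw [← forall_crf]
  refine forall_congr' fun k => ?_
  rw [← forall_crf]
  refine forall_congr' fun k' => ?_
  rw [conj_apply, adapted_conjPt, conj_apply, adapted_conjPt, coord_conjPt, coord_conjPt, settledAbove_conj, settledAbove_conj,
    coveredAbove_conj]

/-- **RULE-D closure is chirality-blind.** -/
theorem ruleDMu4Closed_conjImage : RuleDMu4Closed C.conjImage ↔ RuleDMu4Closed C := by
  simp only [RuleDMu4Closed, forall_conjImage_lower, forall_conjImage_upper, ruleDMu4N_conj, ruleDMu4P_conj]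

end RuleD

end Chirality

end Summit.Ventures.HSemireg.Pad4Tower
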